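import Summits.BirchSwinnertonDyer.BirchSwinnertonDyer.Theorems.TwoAdicConverseModFourTraceLegendreForm
import HarnessLib

/-!
# Route `TwoAdicConverse` (rung S3), crux `OrdLambdaHalfAtTwo` (item 19556): the mod-`4` EISENSTEIN CONGRUENCE from a
# rational CYCLIC `4`-ISOGENY — K0's globally-square cases

Cell `bsd-2adic`, seat `bsd-2adic-conv-1` (GEN 21). THEOREMS ONLY — no named fact, no definition, nothing conditional. Corollary of
K0 (`TwoAdicConverseModFourTraceOneTwoTorsionPoint`): if one of the two square classes of K0 is GLOBALLY trivial — `Δ ∈ ℚ×²` (full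
rational `2`-torsion: the case of `eisensteinCongruenceModFour`, GEN 5) or `B = 3m² + 2b₂m + 8b₄ ∈ ℤ²` (equivalently
`B' = 3x² + (b₂/2)x + b₄/2 ∈ ℚ×²`: the rational point `P` of order `2` lies in the image of the dual `2`-isogeny, i.e. `E` has a
rational CYCLIC `4`-isogeny with kernel `∋ P`, Silverman X.4.9: `δ(T) = b mod squares`) — then **`4 ∣ #W̃(𝔽_ℓ)` and `a_ℓ ≡ ℓ + 1 (mod 4)`
at EVERY odd good prime `ℓ`**: `f_E ≡ E₂ (mod 4)` on all `T_ℓ`, `ℓ ∤ 2N` (Mazur's Eisenstein prime `2` for the cyclic-`4`-isogeny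
locus, the elementary direction of Katz 1981). The converse («`4 ∣ #W̃(𝔽_ℓ)` for almost all `ℓ` ⇒ one of the two classes is a
global square») needs Čebotarev and is NOT claimed.

* `four_dvd_reductionPointCount_of_isSquare_int` / `four_dvd_succ_sub_frobeniusTrace_of_isSquare_int` — integer square class `B`
  or `Δ`;
* `four_dvd_succ_sub_frobeniusTrace_of_isSquare_rat` — the rational form `IsSquare (3x² + (b₂/2)x + b₄/2)`;
* `exists_cuspCoeff_eq_of_isSquare_int` — `a_ℓ(f) = ℓ + 1 + 4j` for any newform `f` of `W`.

HONEST FRAMING: elementary; nothing about `λ` or BSD; items 19556 / 19218 stay OPEN; BSD is not proved by any of this.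
PARTITION (D-0054): none — RANK axis (S3). References: B. Mazur, Publ. IHÉS 47 (1977) II.§9/§14 [Mazur1977]; N. Katz, Invent.
Math. 62 (1981), Galois properties of torsion points on abelian varieties (the converse direction, not used); J. H. Silverman, *AEC* (2009), X.4.9 [SilvermanAEC2009].
-/

set_option linter.dupNamespace false
set_option autoImplicit false

noncomputable section

open scoped Classical
open WeierstrassCurve Literature.NumberTheory.EllipticCurves Literature.NumberTheory.EllipticCurves.Greenberg1999
  Literature.NumberTheory.EllipticCurves.ModularForms

namespace Summit.BirchSwinnertonDyer.BirchSwinnertonDyer.Theorems.TwoAdicTwistConverse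

variable (W : WeierstrassCurve ℚ) [W.IsElliptic] [W.IsGloballyMinimal] (ℓ : ℕ) [Fact ℓ.Prime]

omit [W.IsElliptic] in
/-- **`4 ∣ #W̃(𝔽_ℓ)` at every odd good prime when `B` or `Δ` is an INTEGER square** (rational cyclic `4`-isogeny through `P`, or full
rational `2`-torsion). [cite: SilvermanAEC2009, X.4.9] [cite: Mazur1977, II.§9] -/
theorem four_dvd_reductionPointCount_of_isSquare_int (hℓ : ℓ ≠ 2) (hgood : W.HasGoodReductionAtPrime ℓ) {x : ℚ}
    (hx : HasRationalTwoTorsionX W x) {m : ℤ} (hm : (m : ℚ) = 4 * x)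
    (hsq : IsSquare (3 * m ^ 2 + 2 * (integralModelInt W).b₂ * m + 8 * (integralModelInt W).b₄) ∨
      IsSquare (minimalDiscriminantInt W)) :
    4 ∣ W.reductionPointCount ℓ := by
  rw [four_dvd_reductionPointCount_iff_of_hasRationalTwoTorsionX W ℓ hℓ hgood hx hm]
  rcases hsq with ⟨r, hr⟩ | ⟨r, hr⟩
  · exact Or.inl ⟨(r : ZMod ℓ), by rw [hr]; push_cast; ring⟩
  · exact Or.inr ⟨(r : ZMod ℓ), by rw [hr]; push_cast; ring⟩

omit [W.IsElliptic] in
/-- **`a_ℓ ≡ ℓ + 1 (mod 4)` at every odd good prime when `B` or `Δ` is an integer square** — the mod-`4` Eisenstein congruence on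
the rational-cyclic-`4`-isogeny / full-`2`-torsion locus (extends `eisensteinCongruenceModFour`). [cite: Mazur1977, II.§9 and II.§14]
[cite: SilvermanAEC2009, X.4.9 and V.2.3.1] -/
theorem four_dvd_succ_sub_frobeniusTrace_of_isSquare_int (hℓ : ℓ ≠ 2) (hgood : W.HasGoodReductionAtPrime ℓ) {x : ℚ}
    (hx : HasRationalTwoTorsionX W x) {m : ℤ} (hm : (m : ℚ) = 4 * x)
    (hsq : IsSquare (3 * m ^ 2 + 2 * (integralModelInt W).b₂ * m + 8 * (integralModelInt W).b₄) ∨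
      IsSquare (minimalDiscriminantInt W)) :
    (4 : ℤ) ∣ (ℓ : ℤ) + 1 - W.frobeniusTrace ℓ := by
  rw [WeierstrassCurve.frobeniusTrace, sub_sub_cancel]
  exact_mod_cast four_dvd_reductionPointCount_of_isSquare_int W ℓ hℓ hgood hx hm hsq

/-- **Rational form**: if `B' = 3x² + (b₂/2)x + b₄/2` is a rational square (the `b`-coefficient of the centred model
`y² = X(X² + A'X + B')`, so `T = (0,0)` is divisible by the dual `2`-isogeny: a rational cyclic `4`-isogeny) then
`a_ℓ ≡ ℓ + 1 (mod 4)` at every odd good prime `ℓ`. [cite: SilvermanAEC2009, X.4.9] [cite: Mazur1977, II.§9] -/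
theorem four_dvd_succ_sub_frobeniusTrace_of_isSquare_rat (hℓ : ℓ ≠ 2) (hgood : W.HasGoodReductionAtPrime ℓ) {x : ℚ}
    (hx : HasRationalTwoTorsionX W x) (hsq : IsSquare (3 * x ^ 2 + W.b₂ / 2 * x + W.b₄ / 2)) :
    (4 : ℤ) ∣ (ℓ : ℤ) + 1 - W.frobeniusTrace ℓ := by
  obtain ⟨m, hm⟩ := exists_int_eq_four_mul_of_hasRationalTwoTorsionX W hx
  refine four_dvd_succ_sub_frobeniusTrace_of_isSquare_int W ℓ hℓ hgood hx hm (Or.inl ?_)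
  have hb₂ : ((integralModelInt W).b₂ : ℚ) = W.b₂ := by
    simpa only [map_b₂, eq_intCast] using congrArg WeierstrassCurve.b₂ (map_integralModelInt W)
  have hb₄ : ((integralModelInt W).b₄ : ℚ) = W.b₄ := by
    simpa only [map_b₄, eq_intCast] using congrArg WeierstrassCurve.b₄ (map_integralModelInt W)
  rw [← Rat.isSquare_intCast_iff]
  obtain ⟨q, hq⟩ := hsq
  refine ⟨4 * q, ?_⟩
  push_cast
  rw [hb₂, hb₄, hm]
  linear_combination 16 * hq

/-- **`f_E ≡ E₂ (mod 4)` on `T_ℓ`** for any newform `f` of `W` (`IsNewformOf W f`), under the same integer-square hypothesis: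
`a_ℓ(f) = ℓ + 1 + 4j`, `j ∈ ℤ`, at every odd good prime `ℓ`. [cite: Mazur1977, II.§9 and II.§14] [cite: SilvermanAEC2009, V.2.3.1] -/
theorem exists_cuspCoeff_eq_of_isSquare_int {N : ℕ} [NeZero N] {f : CuspForm (CongruenceSubgroup.Gamma0 N) 2}
    (hf : IsNewformOf W f) (hℓ : ℓ ≠ 2) (hgood : W.HasGoodReductionAtPrime ℓ) {x : ℚ}
    (hx : HasRationalTwoTorsionX W x) {m : ℤ} (hm : (m : ℚ) = 4 * x)
    (hsq : IsSquare (3 * m ^ 2 + 2 * (integralModelInt W).b₂ * m + 8 * (integralModelInt W).b₄) ∨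
      IsSquare (minimalDiscriminantInt W)) :
    ∃ j : ℤ, cuspCoeff f ℓ = (((ℓ : ℤ) + 1 + 4 * j : ℤ) : ℂ) := by
  obtain ⟨k, hk⟩ := four_dvd_succ_sub_frobeniusTrace_of_isSquare_int W ℓ hℓ hgood hx hm hsq
  refine ⟨-k, ?_⟩
  rw [hf.2 ℓ, W.LFunction_apply_prime_eq_frobeniusTrace ℓ hgood]
  congr 1
  linear_combination -hk

end Summit.BirchSwinnertonDyer.BirchSwinnertonDyer.Theorems.TwoAdicTwistConverse

end
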